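import Literature.Topology.FourManifolds.DehnSurgeryTubularNbhdProofs
import Literature.Topology.FourManifolds.StraightLineIsotopyExtension
import HarnessLib

/-!
# A tube along an embedded compact arc in `ℝ³`, and smooth extension of functions from the arc

Topic `Literature/Topology/FourManifolds`; infrastructure for the proof programme of the
Fox–Milnor fact `Literature.Topology.FourManifolds.Knot.exists_isConnectedSum_isConcordant`
(straightening a spanning arc of the second concordance, where a smooth function on `ℝ³` with
prescribed values along an embedded arc is needed). Everything here is proved; no named fact is
introduced.

* `ArcTube.cr u v` — the cross product on `𝔼 3 = EuclideanSpace ℝ (Fin 3)` (Mathlib's `⨯₃` on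
  coordinates): orthogonal to both factors, nonzero on orthogonal nonzero vectors, smooth.
* `ArcTube.exists_normalFrame` — along a `C^∞` curve `c : ℝ → ℝ³`, regular on a set `S`, there
  are `C^∞` fields `N₁`, `N₂` which on `S` are nonzero, orthogonal to each other and to `c'`
  (`N₁ = c' × e` for a direction `e` nowhere parallel to `c'` on `S`, easy Sard; `N₂ = c' × N₁`).
* `ArcTube.tube c N₁ N₂ (τ, (d₁, d₂)) = c τ + d₁ N₁ τ + d₂ N₂ τ` — the affine tube; its derivative
  along the zero section (`hasFDerivAt_tube_zero`, `tubeL`) is injective for such a frame.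
* `ArcTube.exists_injOn_tube` — **a uniform injective tube around a compact embedded arc**: if `c`
  is injective and regular on `[a - κ, b + κ]` then for some frame and some `r > 0` the tube is
  injective with injective derivative on `[a - κ, b + κ] × B(0, r)` (injectivity spreads from the
  compact zero section, `exists_isOpen_injOn_of_isCompact`; the width is uniform by the tube
  lemma) — the pattern of `StripFrame.TubeSetup.exists_injOn_tube` (`ConcordanceStripTube.lean`)
  one dimension down.
* `ArcTube.exists_contDiff_extend` — **smooth extension from an embedded arc with support
  control**: for such `c`, any `ρ > 0` and any `C^∞` function `φ : ℝ → ℝ` vanishing off `(a, b)`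
  there is a `C^∞` function `g : ℝ³ → ℝ` with `g (c τ) = φ τ` on `[a - κ/2, b + κ/2]`, with
  `g y ≠ 0` only within distance `ρ` of a point `c τ`, `τ ∈ (a, b)`, `φ τ ≠ 0`, and
  `|g y| ≤ |φ τ|` for some `τ ∈ [a, b]` (the function `φ (pr₁ (tube⁻¹ y)) χ (pr₂ (tube⁻¹ y))`
  on the open tube image, `χ` a bump in the normal disc, extended by zero; the inverse of the tube
  is smooth on the open image by the inverse function theorem).

## References

* M. W. Hirsch, *Differential Topology*, GTM 33 (1976), Ch. 4 §5 (tubular neighbourhoods; Ex. 5).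
  [HirschDT1976]
* A. A. Kosinski, *Differential Manifolds* (1993), III §2 (tubular neighbourhoods), III (3.1).
  [Kosinski1993]

## Design notes

Elementary and self-contained (`𝔼 3`-valued calculus only); `𝔼 n` is local notation as in
`Knots.lean`. No named facts, no `sorry`.
-/

open scoped Topology ContDiff RealInnerProductSpace Matrix
open Function Set Metric Filter

noncomputable section

namespace Literature.Topology.FourManifolds

/-- Local notation: `𝔼 n` is the model Euclidean space `EuclideanSpace ℝ (Fin n)`. -/
local notation "𝔼 " n:arg => EuclideanSpace ℝ (Fin n)

namespace ArcTube

/-! ### The cross product on `𝔼 3` -/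

/-- The cross product on `𝔼 3` (Mathlib's `crossProduct` on coordinates). [folklore] -/
def cr (u v : 𝔼 3) : 𝔼 3 := WithLp.toLp 2 (WithLp.ofLp u ⨯₃ WithLp.ofLp v)

/-- Coordinates of the cross product. [folklore] -/
@[simp] theorem ofLp_cr (u v : 𝔼 3) : WithLp.ofLp (cr u v) = WithLp.ofLp u ⨯₃ WithLp.ofLp v := rfl

/-- The inner product of `𝔼 3` is the dot product of coordinates. [folklore] -/
theorem inner_eq_dotProduct (u v : 𝔼 3) : ⟪u, v⟫ = WithLp.ofLp u ⬝ᵥ WithLp.ofLp v := by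
  rw [EuclideanSpace.inner_eq_star_dotProduct, star_trivial, dotProduct_comm]

/-- `u × v ⊥ u`. [folklore] -/
@[simp] theorem inner_cr_left (u v : 𝔼 3) : ⟪cr u v, u⟫ = 0 := by
  rw [inner_eq_dotProduct, ofLp_cr, dotProduct_comm]
  exact dot_self_cross _ _

/-- `u × v ⊥ v`. [folklore] -/
@[simp] theorem inner_cr_right (u v : 𝔼 3) : ⟪cr u v, v⟫ = 0 := by
  rw [inner_eq_dotProduct, ofLp_cr, dotProduct_comm]
  exact dot_cross_self _ _

/-- The cross product of a nonzero vector with a vector which is not a multiple of it is nonzero.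
[folklore] -/
theorem cr_ne_zero_of_forall_smul_ne {u v : 𝔼 3} (hu : u ≠ 0) (hv : ∀ r : ℝ, r • u ≠ v) :
    cr u v ≠ 0 := by
  intro h
  have h0 : WithLp.ofLp u ⨯₃ WithLp.ofLp v = 0 := by
    rw [← ofLp_cr, h]; rfl
  refine cross_ne_zero_of_forall_smul_ne (v := WithLp.ofLp u) (e := WithLp.ofLp v) ?_ ?_ h0
  · intro h'
    apply hu
    ext i
    have := congrFun h' i
    simpa using this
  · intro r hr
    apply hv r
    ext i
    have := congrFun hr i
    simpa using this

/-- The cross product of two nonzero orthogonal vectors is nonzero. [folklore] -/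
theorem cr_ne_zero_of_inner_eq_zero {u v : 𝔼 3} (hu : u ≠ 0) (hv : v ≠ 0) (h : ⟪u, v⟫ = 0) :
    cr u v ≠ 0 := by
  refine cr_ne_zero_of_forall_smul_ne hu fun r hr ↦ ?_
  have h1 : ⟪u, r • u⟫ = 0 := by rw [hr]; exact h
  rw [real_inner_smul_right, real_inner_self_eq_norm_sq] at h1
  rcases mul_eq_zero.1 h1 with h2 | h2
  · subst h2; rw [zero_smul] at hr; exact hv hr.symm
  · exact hu (norm_eq_zero.1 (pow_eq_zero_iff (n := 2) (by norm_num) |>.1 h2))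

/-- The cross product of smooth fields is smooth. [folklore] -/
theorem contDiff_cr {X : Type*} [NormedAddCommGroup X] [NormedSpace ℝ X] {f g : X → 𝔼 3}
    (hf : ContDiff ℝ ∞ f) (hg : ContDiff ℝ ∞ g) : ContDiff ℝ ∞ fun x ↦ cr (f x) (g x) := by
  have hfc : ∀ i : Fin 3, ContDiff ℝ ∞ fun x ↦ f x i := fun i ↦ contDiff_euclidean.1 hf i
  have hgc : ∀ i : Fin 3, ContDiff ℝ ∞ fun x ↦ g x i := fun i ↦ contDiff_euclidean.1 hg i
  rw [contDiff_euclidean]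
  intro i
  fin_cases i <;>
    simp only [cr, cross_apply] <;>
    first
    | exact ((hfc 1).mul (hgc 2)).sub ((hfc 2).mul (hgc 1))
    | exact ((hfc 2).mul (hgc 0)).sub ((hfc 0).mul (hgc 2))
    | exact ((hfc 0).mul (hgc 1)).sub ((hfc 1).mul (hgc 0))

/-! ### A normal frame along a regular curve -/

/-- **Easy Sard along a set**: a `C¹` field `v : ℝ → ℝ³`, nonzero on `S`, misses some direction
along `S`: some `e` with `v θ × e ≠ 0` for all `θ ∈ S` (as `exists_forall_cross_ne_zero`, the
cone `{r v(θ)}` being the `C¹` image of `ℝ²`). [folklore] -/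
theorem exists_forall_cr_ne_zero {v : ℝ → 𝔼 3} (hv : ContDiff ℝ 1 v) {S : Set ℝ}
    (h0 : ∀ θ ∈ S, v θ ≠ 0) : ∃ e : 𝔼 3, ∀ θ ∈ S, cr (v θ) e ≠ 0 := by
  set f : ℝ × ℝ → 𝔼 3 := fun q ↦ q.1 • v q.2 with hf
  have hfd : ContDiff ℝ 1 f := contDiff_fst.smul (hv.comp contDiff_snd)
  have hdim : Module.finrank ℝ (ℝ × ℝ) < Module.finrank ℝ (𝔼 3) := by simp
  obtain ⟨e, he⟩ := (hfd.dense_compl_range_of_finrank_lt_finrank hdim).nonempty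
  exact ⟨e, fun θ hθ ↦ cr_ne_zero_of_forall_smul_ne (h0 θ hθ) fun r hr ↦ he ⟨(r, θ), hr⟩⟩

/-- The velocity of a `C^∞` curve is `C^∞`. [folklore] -/
theorem contDiff_deriv {c : ℝ → 𝔼 3} (hc : ContDiff ℝ ∞ c) : ContDiff ℝ ∞ (deriv c) :=
  (contDiff_infty_iff_deriv.1 hc).2

/-- **A normal frame along a regular curve.** Along a `C^∞` curve `c : ℝ → ℝ³` with `c' ≠ 0` on
`S` there are `C^∞` fields `N₁`, `N₂` which on `S` are nonzero, orthogonal to each other and to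
`c'` (`N₁ = c' × e`, `e` a direction nowhere parallel to `c'` on `S`; `N₂ = c' × N₁`).
Hirsch (1976), Ch. 4 §5. [folklore] -/
theorem exists_normalFrame {c : ℝ → 𝔼 3} (hc : ContDiff ℝ ∞ c) {S : Set ℝ}
    (hreg : ∀ τ ∈ S, deriv c τ ≠ 0) :
    ∃ N₁ N₂ : ℝ → 𝔼 3, ContDiff ℝ ∞ N₁ ∧ ContDiff ℝ ∞ N₂ ∧ ∀ τ ∈ S,
      ⟪N₁ τ, deriv c τ⟫ = 0 ∧ ⟪N₂ τ, deriv c τ⟫ = 0 ∧ ⟪N₂ τ, N₁ τ⟫ = 0 ∧ N₁ τ ≠ 0 ∧ N₂ τ ≠ 0 := by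
  have hd := contDiff_deriv hc
  obtain ⟨e, he⟩ := exists_forall_cr_ne_zero (hd.of_le (by simp)) hreg
  refine ⟨fun τ ↦ cr (deriv c τ) e, fun τ ↦ cr (deriv c τ) (cr (deriv c τ) e),
    contDiff_cr hd contDiff_const, contDiff_cr hd (contDiff_cr hd contDiff_const), fun τ hτ ↦ ?_⟩
  refine ⟨inner_cr_left _ _, inner_cr_left _ _, inner_cr_right _ _, he τ hτ, ?_⟩
  refine cr_ne_zero_of_inner_eq_zero (hreg τ hτ) (he τ hτ) ?_
  rw [real_inner_comm]
  exact inner_cr_left _ _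

/-! ### The affine tube of a framed curve -/

/-- **The affine tube** of the framed curve `(c; N₁, N₂)`:
`(τ, (d₁, d₂)) ↦ c τ + d₁ N₁ τ + d₂ N₂ τ`. [folklore] -/
def tube (c N₁ N₂ : ℝ → 𝔼 3) (p : ℝ × ℝ × ℝ) : 𝔼 3 :=
  c p.1 + p.2.1 • N₁ p.1 + p.2.2 • N₂ p.1

variable {c N₁ N₂ : ℝ → 𝔼 3}

/-- The tube on the zero section is the curve. [folklore] -/
@[simp] theorem tube_zero (τ : ℝ) : tube c N₁ N₂ (τ, 0) = c τ := by
  simp [tube]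

/-- The tube is `C^∞`. [folklore] -/
theorem contDiff_tube (hc : ContDiff ℝ ∞ c) (h₁ : ContDiff ℝ ∞ N₁) (h₂ : ContDiff ℝ ∞ N₂) :
    ContDiff ℝ ∞ (tube c N₁ N₂) :=
  ((hc.comp contDiff_fst).add ((contDiff_fst.comp contDiff_snd).smul (h₁.comp contDiff_fst))).add
    ((contDiff_snd.comp contDiff_snd).smul (h₂.comp contDiff_fst))

/-- The distance from a tube point to the curve point under it. [folklore] -/
theorem dist_tube_le (p : ℝ × ℝ × ℝ) :
    dist (tube c N₁ N₂ p) (c p.1) ≤ |p.2.1| * ‖N₁ p.1‖ + |p.2.2| * ‖N₂ p.1‖ := by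
  rw [dist_eq_norm, tube, show c p.1 + p.2.1 • N₁ p.1 + p.2.2 • N₂ p.1 - c p.1 =
    p.2.1 • N₁ p.1 + p.2.2 • N₂ p.1 by abel]
  refine (norm_add_le _ _).trans ?_
  rw [norm_smul, norm_smul, Real.norm_eq_abs, Real.norm_eq_abs]

/-- **The derivative of the tube along the zero section**: `(δτ, (δ₁, δ₂)) ↦ δτ c' τ + δ₁ N₁ τ + δ₂ N₂ τ`.
[folklore] -/
def tubeL (c N₁ N₂ : ℝ → 𝔼 3) (τ : ℝ) : ℝ × ℝ × ℝ →L[ℝ] 𝔼 3 :=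
  (ContinuousLinearMap.fst ℝ ℝ (ℝ × ℝ)).smulRight (deriv c τ) +
    ((ContinuousLinearMap.fst ℝ ℝ ℝ).comp (ContinuousLinearMap.snd ℝ ℝ (ℝ × ℝ))).smulRight (N₁ τ) +
    ((ContinuousLinearMap.snd ℝ ℝ ℝ).comp (ContinuousLinearMap.snd ℝ ℝ (ℝ × ℝ))).smulRight (N₂ τ)

/-- Evaluation of `tubeL`. [folklore] -/
@[simp] theorem tubeL_apply (τ : ℝ) (q : ℝ × ℝ × ℝ) :
    tubeL c N₁ N₂ τ q = q.1 • deriv c τ + q.2.1 • N₁ τ + q.2.2 • N₂ τ := by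
  simp [tubeL]

/-- The tube has derivative `tubeL τ` at the point `(τ, 0)` of the zero section. [folklore] -/
theorem hasFDerivAt_tube_zero (hc : ContDiff ℝ ∞ c) (h₁ : ContDiff ℝ ∞ N₁) (h₂ : ContDiff ℝ ∞ N₂)
    (τ : ℝ) : HasFDerivAt (tube c N₁ N₂) (tubeL c N₁ N₂ τ) (τ, 0) := by
  set p : ℝ × ℝ × ℝ := (τ, 0) with hp
  have hc' : HasFDerivAt (fun q : ℝ × ℝ × ℝ ↦ c q.1)
      (((1 : ℝ →L[ℝ] ℝ).smulRight (deriv c τ)).comp (ContinuousLinearMap.fst ℝ ℝ (ℝ × ℝ))) p :=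
    ((hc.differentiable (by simp)) τ).hasDerivAt.hasFDerivAt.comp p hasFDerivAt_fst
  have hN₁ : HasFDerivAt (fun q : ℝ × ℝ × ℝ ↦ N₁ q.1)
      (((1 : ℝ →L[ℝ] ℝ).smulRight (deriv N₁ τ)).comp (ContinuousLinearMap.fst ℝ ℝ (ℝ × ℝ))) p :=
    ((h₁.differentiable (by simp)) τ).hasDerivAt.hasFDerivAt.comp p hasFDerivAt_fst
  have hN₂ : HasFDerivAt (fun q : ℝ × ℝ × ℝ ↦ N₂ q.1)
      (((1 : ℝ →L[ℝ] ℝ).smulRight (deriv N₂ τ)).comp (ContinuousLinearMap.fst ℝ ℝ (ℝ × ℝ))) p :=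
    ((h₂.differentiable (by simp)) τ).hasDerivAt.hasFDerivAt.comp p hasFDerivAt_fst
  have hs₁ : HasFDerivAt (fun q : ℝ × ℝ × ℝ ↦ q.2.1)
      ((ContinuousLinearMap.fst ℝ ℝ ℝ).comp (ContinuousLinearMap.snd ℝ ℝ (ℝ × ℝ))) p :=
    ((ContinuousLinearMap.fst ℝ ℝ ℝ).comp (ContinuousLinearMap.snd ℝ ℝ (ℝ × ℝ))).hasFDerivAt
  have hs₂ : HasFDerivAt (fun q : ℝ × ℝ × ℝ ↦ q.2.2)
      ((ContinuousLinearMap.snd ℝ ℝ ℝ).comp (ContinuousLinearMap.snd ℝ ℝ (ℝ × ℝ))) p :=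
    ((ContinuousLinearMap.snd ℝ ℝ ℝ).comp (ContinuousLinearMap.snd ℝ ℝ (ℝ × ℝ))).hasFDerivAt
  have h := (hc'.add (hs₁.smul hN₁)).add (hs₂.smul hN₂)
  refine h.congr_fderiv ?_
  ext q <;> simp [hp, tubeL]

/-- **The derivative along the zero section is injective** where the frame vectors are nonzero
and orthogonal to each other and to the nonzero velocity. [folklore] -/
theorem injective_tubeL {τ : ℝ} (hc : deriv c τ ≠ 0) (hN₁ : N₁ τ ≠ 0) (hN₂ : N₂ τ ≠ 0)
    (h1c : ⟪N₁ τ, deriv c τ⟫ = 0) (h2c : ⟪N₂ τ, deriv c τ⟫ = 0) (h21 : ⟪N₂ τ, N₁ τ⟫ = 0) :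
    Injective (tubeL c N₁ N₂ τ) := by
  refine (injective_iff_map_eq_zero _).2 fun q hq ↦ ?_
  rw [tubeL_apply] at hq
  have h1c' : ⟪deriv c τ, N₁ τ⟫ = 0 := by rw [real_inner_comm]; exact h1c
  have h2c' : ⟪deriv c τ, N₂ τ⟫ = 0 := by rw [real_inner_comm]; exact h2c
  have h21' : ⟪N₁ τ, N₂ τ⟫ = 0 := by rw [real_inner_comm]; exact h21
  have e1 := congrArg (fun x ↦ ⟪x, deriv c τ⟫) hq
  have e2 := congrArg (fun x ↦ ⟪x, N₁ τ⟫) hq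
  have e3 := congrArg (fun x ↦ ⟪x, N₂ τ⟫) hq
  simp only [inner_add_left, real_inner_smul_left, inner_zero_left, real_inner_self_eq_norm_sq,
    h1c, h2c, h21, h1c', h2c', h21', mul_zero, add_zero, zero_add] at e1 e2 e3
  have hc2 : ‖deriv c τ‖ ^ 2 ≠ 0 := pow_ne_zero _ (norm_ne_zero_iff.2 hc)
  have h12 : ‖N₁ τ‖ ^ 2 ≠ 0 := pow_ne_zero _ (norm_ne_zero_iff.2 hN₁)
  have h22 : ‖N₂ τ‖ ^ 2 ≠ 0 := pow_ne_zero _ (norm_ne_zero_iff.2 hN₂)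
  have q1 : q.1 = 0 := (mul_eq_zero.1 e1).resolve_right hc2
  have q2 : q.2.1 = 0 := (mul_eq_zero.1 e2).resolve_right h12
  have q3 : q.2.2 = 0 := (mul_eq_zero.1 e3).resolve_right h22
  exact Prod.ext q1 (Prod.ext q2 q3)

/-! ### Local and uniform injectivity of the tube -/

/-- `dim (ℝ × ℝ × ℝ) = dim ℝ³`. [folklore] -/
theorem finrank_domain_eq : Module.finrank ℝ (ℝ × ℝ × ℝ) = Module.finrank ℝ (𝔼 3) := by
  simp [Module.finrank_prod]

/-- At a point where the derivative of the (smooth) tube is injective, it is a strict derivative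
which is a linear isomorphism. [folklore] -/
theorem exists_equiv_hasStrictFDerivAt (hT : ContDiff ℝ ∞ (tube c N₁ N₂)) {p : ℝ × ℝ × ℝ}
    (hinj : Injective (fderiv ℝ (tube c N₁ N₂) p)) :
    ∃ L : (ℝ × ℝ × ℝ) ≃L[ℝ] 𝔼 3, (L : (ℝ × ℝ × ℝ) →L[ℝ] 𝔼 3) = fderiv ℝ (tube c N₁ N₂) p ∧
      HasStrictFDerivAt (tube c N₁ N₂) (L : (ℝ × ℝ × ℝ) →L[ℝ] 𝔼 3) p := by
  set L : (ℝ × ℝ × ℝ) ≃L[ℝ] 𝔼 3 :=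
    (LinearMap.linearEquivOfInjective (fderiv ℝ (tube c N₁ N₂) p).toLinearMap hinj
      finrank_domain_eq).toContinuousLinearEquiv with hL
  have hLe : (L : (ℝ × ℝ × ℝ) →L[ℝ] 𝔼 3) = fderiv ℝ (tube c N₁ N₂) p := by
    refine ContinuousLinearMap.ext fun v ↦ ?_
    simp [hL]
  refine ⟨L, hLe, ?_⟩
  rw [hLe]
  exact hT.contDiffAt.hasStrictFDerivAt (by simp)

/-- **The tube is locally injective at the points where its derivative is injective** (inverse
function theorem). [folklore] -/
theorem exists_nhds_injOn (hT : ContDiff ℝ ∞ (tube c N₁ N₂)) {p : ℝ × ℝ × ℝ}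
    (hinj : Injective (fderiv ℝ (tube c N₁ N₂) p)) :
    ∃ U ∈ 𝓝 p, InjOn (tube c N₁ N₂) U := by
  obtain ⟨L, -, hstrict⟩ := exists_equiv_hasStrictFDerivAt hT hinj
  exact ⟨(hstrict.toOpenPartialHomeomorph _).source,
    (hstrict.toOpenPartialHomeomorph _).open_source.mem_nhds
      (hstrict.mem_toOpenPartialHomeomorph_source),
    (hstrict.toOpenPartialHomeomorph _).injOn⟩

/-- The points where the derivative of the smooth tube is injective form an open set. [folklore] -/
theorem isOpen_setOf_injective_fderiv (hT : ContDiff ℝ ∞ (tube c N₁ N₂)) :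
    IsOpen {p : ℝ × ℝ × ℝ | Injective (fderiv ℝ (tube c N₁ N₂) p)} :=
  ContinuousLinearMap.isOpen_injective.preimage (hT.continuous_fderiv (by simp))

/-- **A uniform injective tube around a compact embedded arc.** If the `C^∞` curve `c` is
injective and regular on `[a - κ, b + κ]`, then for some `C^∞` frame `(N₁, N₂)` and some `r > 0`
the affine tube is injective, with injective derivative, on `[a - κ, b + κ] × B(0, r)`.
Hirsch (1976), Ch. 4 §5 (Ex. 5); Kosinski (1993), III (3.1). [folklore] -/
theorem exists_injOn_tube {c : ℝ → 𝔼 3} (hc : ContDiff ℝ ∞ c) {a b κ : ℝ}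
    (hinj : InjOn c (Icc (a - κ) (b + κ))) (hreg : ∀ τ ∈ Icc (a - κ) (b + κ), deriv c τ ≠ 0) :
    ∃ (N₁ N₂ : ℝ → 𝔼 3) (r : ℝ), ContDiff ℝ ∞ N₁ ∧ ContDiff ℝ ∞ N₂ ∧ 0 < r ∧
      InjOn (tube c N₁ N₂) (Icc (a - κ) (b + κ) ×ˢ ball (0 : ℝ × ℝ) r) ∧
      ∀ p ∈ Icc (a - κ) (b + κ) ×ˢ ball (0 : ℝ × ℝ) r, Injective (fderiv ℝ (tube c N₁ N₂) p) := by
  obtain ⟨N₁, N₂, hN₁, hN₂, hframe⟩ := exists_normalFrame hc hreg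
  have hT : ContDiff ℝ ∞ (tube c N₁ N₂) := contDiff_tube hc hN₁ hN₂
  set T : Set ℝ := Icc (a - κ) (b + κ) with hTdef
  have hTc : IsCompact T := isCompact_Icc
  set K : Set (ℝ × ℝ × ℝ) := T ×ˢ {0} with hK
  have hKc : IsCompact K := hTc.prod isCompact_singleton
  -- injective derivative on the zero section
  have hinj0 : ∀ τ ∈ T, Injective (fderiv ℝ (tube c N₁ N₂) (τ, 0)) := by
    intro τ hτ
    obtain ⟨h1c, h2c, h21, h1, h2⟩ := hframe τ hτ
    rw [(hasFDerivAt_tube_zero hc hN₁ hN₂ τ).fderiv]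
    exact injective_tubeL (hreg τ hτ) h1 h2 h1c h2c h21
  -- injectivity on the zero section
  have hinjK : InjOn (tube c N₁ N₂) K := by
    rintro ⟨τ, d⟩ ⟨hτ, hd⟩ ⟨τ', d'⟩ ⟨hτ', hd'⟩ h
    rw [mem_singleton_iff] at hd hd'
    subst hd hd'
    rw [tube_zero, tube_zero] at h
    exact congrArg (fun t : ℝ ↦ ((t, (0 : ℝ × ℝ)) : ℝ × ℝ × ℝ)) (hinj hτ hτ' h)
  -- local injectivity at the points of the zero section
  have hloc : ∀ p ∈ K, ∃ U ∈ 𝓝 p, InjOn (tube c N₁ N₂) U := by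
    rintro ⟨τ, d⟩ ⟨hτ, hd⟩
    rw [mem_singleton_iff] at hd
    subst hd
    exact exists_nhds_injOn hT (hinj0 τ hτ)
  obtain ⟨V, hVo, hKV, hinjV⟩ := exists_isOpen_injOn_of_isCompact hKc
    (fun p _ ↦ hT.continuous.continuousAt) hinjK hloc
  set W : Set (ℝ × ℝ × ℝ) := V ∩ {p | Injective (fderiv ℝ (tube c N₁ N₂) p)} with hW
  have hWo : IsOpen W := hVo.inter (isOpen_setOf_injective_fderiv hT)
  have hKW : T ×ˢ ({0} : Set (ℝ × ℝ)) ⊆ W := by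
    rintro ⟨τ, d⟩ ⟨hτ, hd⟩
    rw [mem_singleton_iff] at hd
    subst hd
    exact ⟨hKV ⟨hτ, rfl⟩, hinj0 τ hτ⟩
  obtain ⟨u, v, hu, hv, hTu, h0v, huv⟩ :=
    generalized_tube_lemma hTc isCompact_singleton hWo hKW
  obtain ⟨r, hr, hball⟩ := Metric.isOpen_iff.1 hv 0 (h0v (mem_singleton 0))
  exact ⟨N₁, N₂, r, hN₁, hN₂, hr, fun p hp p' hp' h ↦ hinjV (huv ⟨hTu hp.1, hball hp.2⟩).1
    (huv ⟨hTu hp'.1, hball hp'.2⟩).1 h, fun p hp ↦ (huv ⟨hTu hp.1, hball hp.2⟩).2⟩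

/-! ### The open tube and the smoothness of its inverse -/

/-- **On an open set where the smooth tube is injective with injective derivative, its image is
open and its inverse is smooth** (inverse function theorem at each point; the local inverses
agree with the global one by injectivity). [folklore] -/
theorem isOpen_image_and_contDiffOn_invFunOn (hT : ContDiff ℝ ∞ (tube c N₁ N₂))
    {O : Set (ℝ × ℝ × ℝ)} (hO : IsOpen O) (hinjO : InjOn (tube c N₁ N₂) O)
    (hder : ∀ p ∈ O, Injective (fderiv ℝ (tube c N₁ N₂) p)) :
    IsOpen (tube c N₁ N₂ '' O) ∧ ContDiffOn ℝ ∞ (hinjO.toPartialEquiv _ _).symm (tube c N₁ N₂ '' O) ∧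
      ∀ p ∈ O, (hinjO.toPartialEquiv _ _).symm (tube c N₁ N₂ p) = p := by
  set G := (hinjO.toPartialEquiv (tube c N₁ N₂) O).symm with hG
  have hGleft : ∀ p ∈ O, G (tube c N₁ N₂ p) = p := fun p hp ↦
    (hinjO.toPartialEquiv (tube c N₁ N₂) O).left_inv hp
  -- at each point: a local chart on which the global inverse is the local one
  have key : ∀ p ∈ O, ∃ S : Set (𝔼 3), IsOpen S ∧ tube c N₁ N₂ p ∈ S ∧ S ⊆ tube c N₁ N₂ '' O ∧
      ContDiffOn ℝ ∞ G S := by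
    intro p hp
    obtain ⟨L, hLe, hstrict⟩ := exists_equiv_hasStrictFDerivAt hT (hder p hp)
    set e := hstrict.toOpenPartialHomeomorph (tube c N₁ N₂) with he
    have hecoe : (e : ℝ × ℝ × ℝ → 𝔼 3) = tube c N₁ N₂ := hstrict.toOpenPartialHomeomorph_coe
    have hps : p ∈ e.source := hstrict.mem_toOpenPartialHomeomorph_source
    set S : Set (𝔼 3) := e '' (e.source ∩ O) with hS
    have hSo : IsOpen S := e.isOpen_image_of_subset_source (e.open_source.inter hO) inter_subset_left
    have hpS : tube c N₁ N₂ p ∈ S := ⟨p, ⟨hps, hp⟩, by rw [hecoe]⟩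
    have hSsub : S ⊆ tube c N₁ N₂ '' O := by
      rintro _ ⟨q, ⟨-, hq⟩, rfl⟩
      exact ⟨q, hq, by rw [hecoe]⟩
    refine ⟨S, hSo, hpS, hSsub, ?_⟩
    -- on `S`, `G = e.symm`
    have hGe : ∀ y ∈ S, G y = e.symm y := by
      rintro _ ⟨q, ⟨hqs, hqO⟩, rfl⟩
      rw [hecoe, hGleft q hqO]
      have := e.left_inv hqs
      rw [hecoe] at this
      exact this.symm
    intro y hy
    have hy' : y ∈ e.target := by
      obtain ⟨q, ⟨hqs, -⟩, rfl⟩ := hy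
      exact e.map_source hqs
    have hsymm : ContDiffAt ℝ ∞ e.symm y := by
      have hq : e.symm y ∈ e.source := e.map_target hy'
      have hqO : e.symm y ∈ O := by
        obtain ⟨q, ⟨hqs, hqO⟩, rfl⟩ := hy
        rwa [e.left_inv hqs]
      obtain ⟨L', hL'e, hstrict'⟩ := exists_equiv_hasStrictFDerivAt hT (hder _ hqO)
      refine e.contDiffAt_symm hy' (f₀' := L') ?_ ?_
      · rw [hecoe]; exact hstrict'.hasFDerivAt
      · rw [hecoe]; exact hT.contDiffAt
    refine (hsymm.congr_of_eventuallyEq ?_).contDiffWithinAt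
    filter_upwards [hSo.mem_nhds hy] with z hz using hGe z hz
  refine ⟨?_, ?_, hGleft⟩
  · rw [isOpen_iff_mem_nhds]
    rintro _ ⟨p, hp, rfl⟩
    obtain ⟨S, hSo, hpS, hSsub, -⟩ := key p hp
    exact mem_of_superset (hSo.mem_nhds hpS) hSsub
  · rintro _ ⟨p, hp, rfl⟩
    obtain ⟨S, hSo, hpS, hSsub, hGS⟩ := key p hp
    exact (hGS.contDiffAt (hSo.mem_nhds hpS)).contDiffWithinAt

/-! ### Smooth extension from an embedded arc -/

/-- **Smooth extension from an embedded compact arc, with support control.** Let the `C^∞` curve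
`c : ℝ → ℝ³` be injective and regular on `[a - κ, b + κ]` (`κ > 0`), let `ρ > 0`, and let
`φ : ℝ → ℝ` be `C^∞`, vanishing on `(-∞, a]` and on `[b, ∞)`. Then there is a `C^∞` function
`g : ℝ³ → ℝ` with `g (c τ) = φ τ` for `τ ∈ [a - κ/2, b + κ/2]`, such that `g y ≠ 0` only for `y`
within distance `ρ` of some `c τ` with `τ ∈ (a, b)`, `φ τ ≠ 0`, and `|g y| ≤ |φ τ|` for some
`τ ∈ [a, b]`. (The function `φ (pr₁ (tube⁻¹ y)) · χ (pr₂ (tube⁻¹ y))` on the open injective tube,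
`χ` a bump in the normal disc, extended by zero.) Hirsch (1976), Ch. 4 §5. [folklore] -/
theorem exists_contDiff_extend {c : ℝ → 𝔼 3} (hc : ContDiff ℝ ∞ c) {a b κ : ℝ} (hab : a ≤ b)
    (hκ : 0 < κ) (hinj : InjOn c (Icc (a - κ) (b + κ)))
    (hreg : ∀ τ ∈ Icc (a - κ) (b + κ), deriv c τ ≠ 0) {ρ : ℝ} (hρ : 0 < ρ) {φ : ℝ → ℝ}
    (hφ : ContDiff ℝ ∞ φ) (hφa : ∀ τ, τ ≤ a → φ τ = 0) (hφb : ∀ τ, b ≤ τ → φ τ = 0) :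
    ∃ g : 𝔼 3 → ℝ, ContDiff ℝ ∞ g ∧ (∀ τ ∈ Icc (a - κ / 2) (b + κ / 2), g (c τ) = φ τ) ∧
      (∀ y, g y ≠ 0 → ∃ τ ∈ Ioo a b, φ τ ≠ 0 ∧ dist y (c τ) < ρ) ∧
      ∀ y, ∃ τ ∈ Icc a b, |g y| ≤ |φ τ| := by
  obtain ⟨N₁, N₂, r₀, hN₁, hN₂, hr₀, hinjT, hderT⟩ := exists_injOn_tube hc hinj hreg
  have hT : ContDiff ℝ ∞ (tube c N₁ N₂) := contDiff_tube hc hN₁ hN₂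
  set T : Set ℝ := Icc (a - κ) (b + κ) with hTdef
  -- bounds of the frame on the arc
  obtain ⟨M₁, hM₁⟩ := isCompact_Icc.exists_bound_of_continuousOn (s := T) hN₁.continuous.continuousOn
  obtain ⟨M₂, hM₂⟩ := isCompact_Icc.exists_bound_of_continuousOn (s := T) hN₂.continuous.continuousOn
  have hM₁0 : 0 ≤ M₁ := (norm_nonneg _).trans (hM₁ a ⟨by linarith, by linarith⟩)
  have hM₂0 : 0 ≤ M₂ := (norm_nonneg _).trans (hM₂ a ⟨by linarith, by linarith⟩)
  -- the radius
  set r : ℝ := min r₀ (ρ / (M₁ + M₂ + 1)) with hrdef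
  have hr : 0 < r := lt_min hr₀ (by positivity)
  have hrr₀ : r ≤ r₀ := min_le_left _ _
  have hrρ : r * (M₁ + M₂ + 1) ≤ ρ := by
    have : r ≤ ρ / (M₁ + M₂ + 1) := min_le_right _ _
    rwa [le_div_iff₀ (by positivity)] at this
  -- the open tube
  set O : Set (ℝ × ℝ × ℝ) := Ioo (a - κ) (b + κ) ×ˢ ball (0 : ℝ × ℝ) r with hOdef
  have hO : IsOpen O := isOpen_Ioo.prod isOpen_ball
  have hOT : O ⊆ T ×ˢ ball (0 : ℝ × ℝ) r₀ :=
    prod_mono Ioo_subset_Icc_self (ball_subset_ball hrr₀)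
  have hinjO : InjOn (tube c N₁ N₂) O := hinjT.mono hOT
  have hderO : ∀ p ∈ O, Injective (fderiv ℝ (tube c N₁ N₂) p) := fun p hp ↦ hderT p (hOT hp)
  obtain ⟨hUo, hG, hGleft⟩ := isOpen_image_and_contDiffOn_invFunOn hT hO hinjO hderO
  set U : Set (𝔼 3) := tube c N₁ N₂ '' O with hUdef
  set G := (hinjO.toPartialEquiv (tube c N₁ N₂) O).symm with hGdef
  have hGmem : ∀ y ∈ U, G y ∈ O := fun y hy ↦
    (hinjO.toPartialEquiv (tube c N₁ N₂) O).map_target (by rw [hUdef] at hy; exact hy)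
  have hGright : ∀ y ∈ U, tube c N₁ N₂ (G y) = y := fun y hy ↦
    (hinjO.toPartialEquiv (tube c N₁ N₂) O).right_inv (by rw [hUdef] at hy; exact hy)
  -- the bump in the normal disc
  let χ : ContDiffBump (0 : ℝ × ℝ) := ⟨r / 4, r / 2, by positivity, by linarith⟩
  have hχsupp : ∀ d : ℝ × ℝ, (χ : ℝ × ℝ → ℝ) d ≠ 0 → d ∈ ball (0 : ℝ × ℝ) (r / 2) := by
    intro d hd
    have : d ∈ support (χ : ℝ × ℝ → ℝ) := hd
    rwa [χ.support_eq] at this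
  -- the function
  classical
  let g : 𝔼 3 → ℝ := fun y ↦ if y ∈ U then φ (G y).1 * χ (G y).2 else 0
  have hgU : ∀ y ∈ U, g y = φ (G y).1 * χ (G y).2 := fun y hy ↦ if_pos hy
  have hgU' : ∀ y ∉ U, g y = 0 := fun y hy ↦ if_neg hy
  -- where `g ≠ 0`
  have hne : ∀ y, g y ≠ 0 → y ∈ U ∧ φ (G y).1 ≠ 0 ∧ (G y).1 ∈ Ioo a b ∧
      (G y).2 ∈ ball (0 : ℝ × ℝ) (r / 2) := by
    intro y hy
    by_cases hyU : y ∈ U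
    · rw [hgU y hyU] at hy
      have h1 : φ (G y).1 ≠ 0 := left_ne_zero_of_mul hy
      have h2 : (χ : ℝ × ℝ → ℝ) (G y).2 ≠ 0 := right_ne_zero_of_mul hy
      refine ⟨hyU, h1, ⟨?_, ?_⟩, hχsupp _ h2⟩
      · by_contra h; exact h1 (hφa _ (not_lt.1 h))
      · by_contra h; exact h1 (hφb _ (not_lt.1 h))
    · exact absurd (hgU' y hyU) hy
  -- the compact set carrying `g`
  set C : Set (𝔼 3) := tube c N₁ N₂ '' (Icc a b ×ˢ closedBall (0 : ℝ × ℝ) (r / 2)) with hCdef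
  have hCc : IsCompact C := (isCompact_Icc.prod (isCompact_closedBall _ _)).image hT.continuous
  have hCsub : Icc a b ×ˢ closedBall (0 : ℝ × ℝ) (r / 2) ⊆ O :=
    prod_mono (Icc_subset_Ioo (by linarith) (by linarith)) (closedBall_subset_ball (by linarith))
  have hgC : ∀ y ∉ C, g y = 0 := by
    intro y hyC
    by_contra hy
    obtain ⟨hyU, -, hτ, hd⟩ := hne y hy
    exact hyC ⟨G y, ⟨Ioo_subset_Icc_self hτ, ball_subset_closedBall hd⟩, hGright y hyU⟩
  refine ⟨g, ?_, ?_, ?_, ?_⟩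
  · -- smoothness: on `U` a smooth formula, off `C` zero
    rw [contDiff_iff_contDiffAt]
    intro y
    by_cases hyU : y ∈ U
    · have hformula : ContDiffOn ℝ ∞ (fun z ↦ φ (G z).1 * χ (G z).2) U :=
        ((hφ.comp_contDiffOn (contDiffOn_fst.comp hG (mapsTo_univ _ _))).mul
          (χ.contDiff.comp_contDiffOn (contDiffOn_snd.comp hG (mapsTo_univ _ _))))
      refine ((hformula.contDiffAt (hUo.mem_nhds hyU)).congr_of_eventuallyEq ?_)
      filter_upwards [hUo.mem_nhds hyU] with z hz using hgU z hz
    · have hyC : y ∉ C := fun h ↦ hyU (by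
        obtain ⟨p, hp, rfl⟩ := h
        exact ⟨p, hCsub hp, rfl⟩)
      refine (contDiffAt_const (c := (0 : ℝ))).congr_of_eventuallyEq ?_
      filter_upwards [hCc.isClosed.isOpen_compl.mem_nhds hyC] with z hz using hgC z hz
  · -- values on the arc
    intro τ hτ
    have hτO : ((τ, 0) : ℝ × ℝ × ℝ) ∈ O :=
      ⟨⟨by linarith [hτ.1], by linarith [hτ.2]⟩, mem_ball_self hr⟩
    have hcU : c τ ∈ U := ⟨(τ, 0), hτO, tube_zero τ⟩
    rw [hgU _ hcU]
    have hGc : G (c τ) = (τ, 0) := by rw [← tube_zero (c := c) (N₁ := N₁) (N₂ := N₂) τ]; exact hGleft _ hτO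
    rw [hGc]
    simp [χ.one_of_mem_closedBall (mem_closedBall_self (by positivity))]
  · -- support control
    intro y hy
    obtain ⟨hyU, hφ0, hτ, hd⟩ := hne y hy
    refine ⟨(G y).1, hτ, hφ0, ?_⟩
    have hGyT : (G y).1 ∈ T := ⟨by linarith [hτ.1], by linarith [hτ.2]⟩
    have hd' : ‖(G y).2‖ < r / 2 := mem_ball_zero_iff.1 hd
    have h1 : |(G y).2.1| ≤ ‖(G y).2‖ := by
      rw [← Real.norm_eq_abs]; exact norm_fst_le (G y).2
    have h2 : |(G y).2.2| ≤ ‖(G y).2‖ := by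
      rw [← Real.norm_eq_abs]; exact norm_snd_le (G y).2
    calc dist y (c (G y).1) = dist (tube c N₁ N₂ (G y)) (c (G y).1) := by rw [hGright y hyU]
      _ ≤ |(G y).2.1| * ‖N₁ (G y).1‖ + |(G y).2.2| * ‖N₂ (G y).1‖ := dist_tube_le _
      _ ≤ ‖(G y).2‖ * M₁ + ‖(G y).2‖ * M₂ := by
        gcongr
        · exact hM₁ _ hGyT
        · exact hM₂ _ hGyT
      _ < ρ := by nlinarith [norm_nonneg (G y).2]
  · -- bound
    intro y
    by_cases hy : g y = 0
    · exact ⟨a, ⟨le_rfl, hab⟩, by rw [hy, abs_zero]; exact abs_nonneg _⟩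
    · obtain ⟨hyU, -, hτ, -⟩ := hne y hy
      refine ⟨(G y).1, Ioo_subset_Icc_self hτ, ?_⟩
      rw [hgU y hyU, abs_mul]
      have hχ1 : |(χ : ℝ × ℝ → ℝ) (G y).2| ≤ 1 := by
        rw [abs_of_nonneg (χ.nonneg)]; exact χ.le_one
      calc |φ (G y).1| * |(χ : ℝ × ℝ → ℝ) (G y).2| ≤ |φ (G y).1| * 1 := by gcongr
        _ = |φ (G y).1| := mul_one _

end ArcTube

end Literature.Topology.FourManifolds
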